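import Mathlib
import HarnessLib
import HarnessLib.Audit
import Summits.Parity.Statement

/-!
Route: ShiftTauberian

DORMANT since 2026-09-04T13:19:01Z (reconciler: no traction for 5 d (last activity statement-checked at 2026-08-30T12:44:54Z); parked, not closed — `ledger route dormant route-Parity-ShiftTauberian --off` to reactivate) — unstaffed, not closed; items shared with open routes are served there. `ledger route dormant <id> --off` reactivates.

# Route ShiftTauberian — window Hardy–Littlewood at N^(7/30) along a primorial progression plus
majority-to-centre rigidity decide GHL

Decomposition cell D-0178, lens 3 («one certified translation + split beneath»). The ONE translation
is the tree's
d = 1 reduction: GeneralizedHardyLittlewood ⟺ DimOne (necessity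
`generalizedHardyLittlewoodDimOne_of_generalizedHardyLittlewood`,
kernel; sufficiency = the fibration lemma, carried here as the support FibrationLift, verbatim the
open item of
route PrimeDeterminantCells). Beneath it, split DimOne in SHIFT SPACE, Tauberian style («local
average + local rigidity ⇒
pointwise»): around a d = 1 system Ψ = (aᵢn + bᵢ)ᵢ of t forms of size ≤ L look at its
progression-neighbours
Ψ_c = (aᵢn + bᵢ + Q·cᵢ)ᵢ, Q = primorial(max t L) (BOUNDED in N; every prime that can obstruct such a
system divides Q, so
no neighbour is trivially Hardy–Littlewood), c in the window {0,…,W}^t with W = 2^⌊7⌊log₂N⌋/30⌋ ≍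
N^(7/30), filtered to the
admissible (pairwise non-proportional) c. It suffices to show X = WindowHL ∧ RobustRigidity: (A)
WindowHL — all but an
ε-fraction of the admissible neighbours satisfy the Hardy–Littlewood asymptotic to accuracy εN; (R)
RobustRigidity — if all
neighbours outside some minority subset of the window satisfy it to accuracy εN, then Ψ itself
satisfies it to accuracy 2εN.
No card realised (decomposition cell).
Lean: `Summit.Parity.GeneralizedHardyLittlewood.Theses.ShiftTauberian.WindowHL ∧
Summit.Parity.GeneralizedHardyLittlewood.Theses.ShiftTauberian.RobustRigidity`

## Assembly
Pure logic plus Markov (sorry-free in Sketch.lean and glue.lean, axioms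
propext/Classical.choice/Quot.sound): fix t, L, ε;
apply WindowHL at min(ε/2, 1/2) to get an exceptional set B with #B ≤ ½·#G outside which every
neighbour is good to accuracy
(ε/2)N; RobustRigidity at ε/2 with this B gives |E(Ψ)| ≤ 2(ε/2)N = εN, i.e. DimOne; FibrationLift
lifts DimOne to
GeneralizedHardyLittlewood. Necessity of both cruxes is also kernel-checked in Sketch.lean (S ⟹
WindowHL with B = ∅ via
DimOne at size L + t and N ≥ Q²; S ⟹ RobustRigidity because its conclusion is DimOne's with slack).

Rationale: WHY THIS LINE. The only unconditional motion on prime tuples in thirty years is in the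
SHIFT-AVERAGED direction: Hardy–Littlewood for
almost all shifts in windows of length H = X^θ, θ = 1 (Balog 1990 / Kawada 1993, tree fact
`Literature.NumberTheory.Sieve.hardyLittlewoodTuples_almostAllShifts`), θ = 1/3 for pairs
(Mikawa1992), θ = 8/33 for pairs
(MatomakiRadziwillTao2019 = arXiv:1707.01315, Thm 1.3(i)), θ = 1/3 for ℓ-tuples (arXiv:2411.05770,
Thm 1.5; θ = 5/8 via
arXiv:2204.03754); θ = 0 is the conjecture. This line makes the window exponent the DIAL of a
two-piece Tauberian split and
sets it at 7/30 — the next threshold named by Matomäki–Radziwiłł–Tao themselves (1/5 < 11/48 <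
25/108 < 7/30 < 8/33, §1.5:
the d₃-type sums are the obstruction) — so that piece A is an honest next rung of an existing ladder
(Dirichlet-polynomial
large values / Gowers uniformity in short progression windows) while piece R isolates exactly what
averaging can never
give: the passage from «most neighbours» to «this system», typed as a constant-comparison law with
no main term for Ψ of
its own. Imported areas: short-interval multiplicative number theory (MR method, large-value
estimates), higher-order
Fourier analysis (U^s-uniformity in short windows); the combinatorial skeleton is a
Tauberian/majority-vote argument. What
prior routes do not do: every listed GHL route either attacks DimOne head-on through a structural
identity (determinant
cells, Dickson fibration, hyperbolic constellations), splits by Siegel scale (ExceptionalWindows),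
or averages over MODULI
(ClassVarianceLadder, VarianceWitness); none averages over SHIFTS along a bounded-modulus
progression, and none has a piece
that is literally the next rung of the MRT ladder.

RANKED CRUXES. #2 RobustRigidity (crux) — for every t ≥ 1, L, ε > 0 and all large N, every
non-degenerate d = 1 system Ψ of t forms with ‖Ψ‖_N ≤ L and every convex K ⊆ [−N,N]: if B is any
subset of the admissible window G (neighbours Ψ + Q·c, Q = primorial(max t L), c ∈ {0..W}^t, W =
2^⌊7⌊log₂N⌋/30⌋, pairwise non-proportional) with 2·#B ≤ #G, and every neighbour c ∈ G ∖ B has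
Hardy–Littlewood error |S(Ψ_c,K) − β_∞(Ψ_c,K)𝔖(Ψ_c)| ≤ εN, then |S(Ψ,K) − β_∞(Ψ,K)𝔖(Ψ)| ≤ 2εN
(majority-to-centre rigidity in shift space; the parity- and Siegel-carrying piece). [difficulty:
open-problem] (why it might fail: It is false uniformly in N under a Siegel zero
(MatomakiMerikoski2023: at N = q^10 the shift h₀ = 2q is off by a factor 2 while generic neighbours
are fine), so any proof must exclude exceptional characters; no transfer between neighbouring shifts
is known even for pairs.) [MatomakiMerikoski2023, arXiv:1707.01315, GreenTao2010,
HardyLittlewood1923]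
#3 WindowHL (crux) — for every t ≥ 1, L, ε > 0 and all large N, every non-degenerate d = 1 system Ψ
of t forms with ‖Ψ‖_N ≤ L and every convex K ⊆ [−N,N]: there is an exceptional set B ⊆ G with #B ≤
ε·#G such that every admissible neighbour c ∈ G ∖ B satisfies |S(Ψ_c,K) − β_∞(Ψ_c,K)𝔖(Ψ_c)| ≤ εN
(Hardy–Littlewood for almost all neighbours in the N^(7/30)-window along the primorial progression —
one exponent step below the Matomäki–Radziwiłł–Tao record 8/33 for pairs; for t ≥ 3 the statement
contains the pairs slice by summing out the other shifts, and the printed tuple record — MRSTT-II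
Thm 1.5, ONE averaging variable n, n+h, …, n+(ℓ−1)h at θ = 1/3 — is a different, harder shape, so A
is open for every t ≥ 2). [difficulty: XL] (why it might fail: θ = 7/30 < 8/33 needs a Type-d₃/d₄
large-values input beyond Robert–Sargos (MRT-I §1.5, the named obstruction); even A at 8/33 is
printed only for centres h₀ ≤ X^(1−ε), here |h₀| ≤ LN; for t ≥ 3 no multi-shift result sharper than
the pairs slice is in print; no power savings for Λ.) [arXiv:1707.01315, arXiv:2411.05770,
arXiv:2204.03754, Mikawa1992, Kawada1993]
#9 FibrationLift (support) — the one-variable case (d = 1, all t, L, convex K ⊆ [−N,N]) of the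
generalised Hardy–Littlewood conjecture implies the full conjecture in every dimension d (Green–Tao
fibration over d − 1 coordinates; verbatim the open support item of route PrimeDeterminantCells,
proved in the tree's Theorems.LeeYangFibresFibrationLemmaFinal cone as
FibrationGlue.generalizedHardyLittlewood_of_dimOne). [difficulty: provable-now] [GreenTao2010,
arXiv:math/0606088]

TWO-LAYER PLAN. Foreseen glued splits (birth skeletons bc/WindowHL_birth.lean,
bc/RobustRigidity_birth.lean, kernel-checked):
WindowHL ⇐ PairsL1 → TuplesL1 → WindowHL (ℓ¹ window mean in the two regimes the literature
separates, t ≤ 2 via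
Dirichlet-polynomial large values beyond 8/33, t ≥ 3 via U^s-uniformity of Λ in short progression
windows beyond 1/3;
glue = Markov); RobustRigidity ⇐ ArchTransport → CountTransport → RobustRigidity (β_∞·𝔖 is
shift-Lipschitz, provable now;
the count-transport law S(Ψ) − S(Ψ_c) = β_∞(𝔖(Ψ) − 𝔖(Ψ_c)) + o(N) for a strict majority of
neighbours is the heart;
glue = a strict majority meets the complement of a minority + triangle inequality). Kernel hygiene
(T11(e)): R has a
trivial branch — if the centre c = 0 (Ψ is its own neighbour, `neighbour_zero`) lies outside the
exceptional set B, R's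
hypothesis already contains its conclusion (`robustRigidity_trivial_branch` in the cell file); the
heart stub CountTransport is
therefore a statement about the content branch 0 ∈ B (it is stated B-free: a strict majority of
transportable neighbours).

KILL CRITERIA. A refutation of RobustRigidity (e.g. an unconditional construction of a system whose
neighbours are Hardy–Littlewood
but which is not — necessarily disproving DimOne too) closes the route `refuted:RobustRigidity` and
refutes GHL itself.
A proof that WindowHL at exponent 7/30 follows from known zero-density/large-value estimates for ALL
t makes A a theorem
and degenerates the split (R ≡ DimOne mod theorem) — critic trap T11 «notch residuals»: the day
WindowHL at 7/30 lands the
node CONTRACTS, i.e. it is re-dialled to the next notch θ′ of the MRT chain (25/108, then 11/48,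
then 1/5): WindowHL := A_θ′,
RobustRigidity := R_θ′ (new items, the old ones kept as settled edges); this is ladder motion on A's
programme (averaged
correlations / Dirichlet-polynomial large values), reported in that currency, never as distance to
the summit; R carries
ZERO rung credit (declared residual: R ∧ A ⟺ DimOne in the kernel). DimOne proved elsewhere (any
DimOne route) moots the
route; PairsHL-type partial results do not.

NOT DECOMPOSED YET. The Siegel-zero case of RobustRigidity (inside an exceptional window the
secondary term 𝔖_χ is explicit and the transfer
law must carry it); the major/minor-arc or W-trick architecture of WindowHL; the singular-product
upper bound
𝔖(Ψ_c) ≤ (C log log N)^t used by ArchTransport; constants in the admissible-window count (#G ≍ W^t).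
All layer-2.

CHEAPEST FALSIFIER. Lookup + one computation: (i) does MRT 2019 §1.5 / Remark 1.4 or any sequel
(arXiv:2411.05770 §1.3) already give pairs
at H = X^(7/30) along a fixed progression? — searched: no; 8/33 is the standing record for Λ
(d₃-type sums the named
obstruction), 7/30 is reached only for d_k-correlations. (ii) the BC7 tautology probe on both cruxes
(ran 2026-08-30:
CLEAN, CLEAN) and the C → S probes (failed, as required). A refuter's first move: test
RobustRigidity numerically at
N = 10^7 for twins (Q = 2, window 2^⌊7·23/30⌋ = 32): the errors of (n, n+2+2c), c ≤ 32, against the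
centre.

NUMBERS. Shift-window exponents for Hardy–Littlewood on average: θ = 1 (Balog1990, Kawada1993; all
tuples), 1/3 (Mikawa1992; pairs),
8/33 (arXiv:1707.01315 Thm 1.3(i); pairs, H ≥ X^(8/33+ε), exceptional set H·log^(−A)X), 5/8
(arXiv:2204.03754; tuples),
1/3 (arXiv:2411.05770 Thm 1.5; ℓ-tuples, proportion 1 − o(1)); MRT threshold chain 1/5 < 11/48 <
25/108 < 7/30 < 8/33 < 1/4
(arXiv:1707.01315 p. 5–7). This route: θ = 7/30, modulus Q = primorial(max t L) = O_(t,L)(1), slack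
factor 2 in R.
Items at open: 4 (2 cruxes, 1 support, 1 assembly).

DEFINITION REQUESTS. None: AffLinForm, IsNondegenerateSystem, affLinSize, realBox, vonMangoldtSum,
archFactor, singularProduct
(Literature.NumberTheory.Sieve.LinearEquationsInPrimes), primorial, Nat.log, Fintype.piFinset
(Mathlib) exist; the window,
neighbour and admissibility filter are spelled out inline.

Novelty: Searches (2026-08-30): `lit search --hybrid "Hardy-Littlewood prime tuples almost all shifts short
average exceptional set majority"` (8 docs: Tao–Vu, Greaves–Harman–Huxley, arXiv:2109.06291
HL–Chowla with a Siegel zero, none on shift-to-centre transfer); `lit vsearch "<Hardy–Littlewood for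
a fixed shift deduced from most neighbouring shifts, Tauberian in the shift variable>"` (8 docs,
none relevant); `lit galaxy search "prime tuples on average|averaged Hardy-Littlewood|almost all
shifts" --star all` (14 substring rows, all noise); `lit galaxy search "von Mangoldt and higher
divisor functions" --star pdf` (1: [galaxy:pdf:-4037186074583161440] Lichtman–Teräväinen
arXiv:2111.08912, HL–Chowla on average — an averaged rung, not a transfer); corpus reads
[corpus:paper-arxiv-1707.01315 p.5–8], [corpus:paper-arxiv-2411.05770 p.3,6],
[corpus:paper-arxiv-2204.03754 p.7]; tree: rg over Summits/Parity/*/Theses for 8/33|Mikawa|almost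
all shifts|hardyLittlewoodTuples_almostAllShifts (hits only as cited numbers in ClassVarianceLadder,
PoissonVarianceAtom, PrimeDeterminantCells; no route uses shift-window averaging as a piece).
Nearest prior art found: arXiv:1707.01315 (MRT 2019, Thm 1.3(i): pairs for almost all shifts in
windows H ≥ X^(8/33+ε)) and arXiv:2411.05770 (Thm 1.5: ℓ-point HL with one averaging variable, H ≥
X^(1/3+ε)); in the tree, route ExceptionalWindows (Siegel-scale split of the same DimOne) and the
ladder fact hardyLittlewoodTuples_almostAllShifts.
Delta: the shift-window a  [refs: 2109.06291, 2111.08912, 1707.01315, 2411.05770, paper-arxiv-1707.01315, paper-arxiv-2411.05770, paper-arxiv-2204.03754]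

Barriers (technique_class: shift-averaging, large-values, uniform-hardy-littlewood): - technique_class: shift-averaging, large-values, uniform-hardy-littlewood
- Literature.Barriers.Parity.SmallScalePatternIrregularity: quantifies over patterns at scales (log
N)^C / bounded gaps; both pieces live at full scale n ≤ N with shifts ≤ Q·N^(7/30) — outside its
scope.
- Literature.Barriers.Parity.FriedlanderGranvilleUniformityBarrier: kills uniformity in the MODULUS
up to N/(log N)^C; here the modulus Q = primorial(max t L) is bounded in N and only shifts vary —
the barrier's hypothesis (growing modulus) is violated.
- Literature.Barriers.Parity.PrimePairParity: sieve-parity blocks lower bounds for prime pairs from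
Type-I/II information alone; WindowHL is an AVERAGED statement proved (at 8/33, 1/3) by zero-density
/ large-value / Gowers-uniformity inputs that are not sieve axioms, and RobustRigidity is where the
parity weight honestly sits: it does not evade the barrier; the bet is that a comparison law between
neighbouring shift systems (no absolute main term) is not a sieve lower bound and can be attacked by
transference.
- Literature.Barriers.Parity.SelbergParityBarrier: same placement — bites R, not A; R is typed as a
relative statement (errors of Ψ versus errors of its neighbours), the form in which
bilinear/transference methods have beaten parity before (Chen–switching does not apply; honest bet).
- Literature.Barriers.Parity.CircleMethodBinaryBarrier: the binary minor arcs cannot be bounded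
pointwise; A uses them only on average over N^(7/30) shifts (exactly

History (route lifecycle, newest last):
- 2026-09-04T13:19:01Z · DORMANT — reconciler: no traction for 5 d (last activity statement-checked at 2026-08-30T12:44:54Z); parked, not closed — `ledger route dormant route-Parity-ShiftTauberia (operator:999:3368402)

sub-problem: GeneralizedHardyLittlewood · status: dormant · opened planner-decomp-parity-lens-3-g0-0 2026-08-30T03:14:35Z · rev 1 · ledger route-Parity-ShiftTauberian
GENERATED by the gate from the ledger (D-0016/17). Provers cite these decls: `theorem foo : Summit.Parity.GeneralizedHardyLittlewood.Theses.ShiftTauberian.<Decl> := …` in Summits/Parity/GeneralizedHardyLittlewood/Theorems/<Name>.lean.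
-/

namespace Summit.Parity.GeneralizedHardyLittlewood.Theses.ShiftTauberian

open scoped BigOperators Topology Manifold Classical MeasureTheory ProbabilityTheory Matrix InnerProductSpace ComplexConjugate ContinuousMap
open Filter Set Function TopologicalSpace MeasureTheory

attribute [summit_statement] _root_.GeneralizedHardyLittlewood

/-- item stmt-Parity-26469 · crux · rank 2 · SPLIT (gen 1) into SelbergPairs, SelbergTuples, RigidityDescent + glue RobustRigidityGlue · direct attempts still welcome (low priority) · by planner
why it might fail: It is false uniformly in N under a Siegel zero (MatomakiMerikoski2023: at N = q^10 the shift h₀ = 2q is off by a factor 2 while generic neighbours are fine), so any proof must exclude exceptional characters; no transfer between neighbouring shifts is known even for pairs.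
sources: MatomakiMerikoski2023, arXiv:1707.01315, GreenTao2010, HardyLittlewood1923
[crux] for every t ≥ 1, L, ε > 0 and all large N, every non-degenerate d = 1 system Ψ of t forms
with ‖Ψ‖_N ≤ L and every convex K ⊆ [−N,N]: if B is any subset of the admissible window G
(neighbours Ψ + Q·c, Q = primorial(max t L), c ∈ {0..W}^t, W = 2^⌊7⌊log₂N⌋/30⌋, pairwise
non-proportional) with 2·#B ≤ #G, and every neighbour c ∈ G ∖ B has Hardy–Littlewood error |S(Ψ_c,K)
− β_∞(Ψ_c,K)𝔖(Ψ_c)| ≤ εN, then |S(Ψ,K) − β_∞(Ψ,K)𝔖(Ψ)| ≤ 2εN (majority-to-centre rigidity in shift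
space; the parity- and Siegel-carrying piece). [difficulty: open-problem] -/
@[route_item "route-Parity-ShiftTauberian"]
def RobustRigidity : Prop :=
  ∀ (t L : ℕ), 1 ≤ t → ∀ ε : ℝ, 0 < ε → ∃ N₀ : ℕ, ∀ N : ℕ, N₀ ≤ N → ∀ Ψ : Fin t → Literature.NumberTheory.Sieve.AffLinForm 1, Literature.NumberTheory.Sieve.IsNondegenerateSystem Ψ → Literature.NumberTheory.Sieve.affLinSize Ψ N ≤ L → ∀ K : Set (Fin 1 → ℝ), Convex ℝ K → K ⊆ Literature.NumberTheory.Sieve.realBox 1 N → ∀ B ⊆ ((Fintype.piFinset fun _ : Fin t => Finset.range (2 ^ (7 * Nat.log 2 N / 30) + 1)).filter (fun c => ∀ i j : Fin t, i ≠ j → (Ψ i).coeff 0 * ((Ψ j).const + (primorial (max t L) : ℤ) * ((c j : ℕ) : ℤ)) ≠ (Ψ j).coeff 0 * ((Ψ i).const + (primorial (max t L) : ℤ) * ((c i : ℕ) : ℤ)))), 2 * B.card ≤ ((Fintype.piFinset fun _ : Fin t => Finset.range (2 ^ (7 * Nat.log 2 N / 30) + 1)).filter (fun c => ∀ i j : Fin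 t, i ≠ j → (Ψ i).coeff 0 * ((Ψ j).const + (primorial (max t L) : ℤ) * ((c j : ℕ) : ℤ)) ≠ (Ψ j).coeff 0 * ((Ψ i).const + (primorial (max t L) : ℤ) * ((c i : ℕ) : ℤ)))).card → (∀ c ∈ ((Fintype.piFinset fun _ : Fin t => Finset.range (2 ^ (7 * Nat.log 2 N / 30) + 1)).filter (fun c => ∀ i j : Fin t, i ≠ j → (Ψ i).coeff 0 * ((Ψ j).const + (primorial (max t L) : ℤ) * ((c j : ℕ) : ℤ)) ≠ (Ψ j).coeff 0 * ((Ψ i).const + (primorial (max t L) : ℤ) * ((c i : ℕ) : ℤ)))), c ∉ B → |Literature.NumberTheory.Sieve.vonMangoldtSum (fun i : Fin t => (⟨(Ψ i).coeff, (Ψ i).const + (primorial (max t L) : ℤ) * ((c i : ℕ) : ℤ)⟩ : Literature.NumberTheory.Sieve.AffLinForm 1)) K N - Literature.NumberTheory.Sieve.archFactor (fun i : Fin t => (⟨(Ψ i).coeff, (Ψ i).const + (primorial (max t L) : ℤ) * ((c i : ℕ) : ℤ)⟩ : Literature.NumberTheory.Sieve.AffLinForm 1)) K * Literature.NumberTheory.Sieve.singularProduct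 (fun i : Fin t => (⟨(Ψ i).coeff, (Ψ i).const + (primorial (max t L) : ℤ) * ((c i : ℕ) : ℤ)⟩ : Literature.NumberTheory.Sieve.AffLinForm 1))| ≤ ε * (N : ℝ)) → |Literature.NumberTheory.Sieve.vonMangoldtSum Ψ K N - Literature.NumberTheory.Sieve.archFactor Ψ K * Literature.NumberTheory.Sieve.singularProduct Ψ| ≤ 2 * ε * (N : ℝ)

-- parent: RobustRigidity · child (gen 1)
/--     item stmt-Parity-27490 · crux · rank 201 · open
    parent: RobustRigidity · by planner
    why it might fail: False only with GHL(d=1,t≤2) (kernel: GHL ⟹ it). As a target: needs the level-1/2 asymptotic-sieve lower ratios of the two rows to sum to ≥ 1/2 (Bombieri's c₂ ≤ 3/4 unverified); else level > 1/2 for rank-2 weights — LargeSieveLevelHalf / LinearSieveOptimality territory.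
    sources: doi:10.4064/aa-28-2-177-193, arXiv:math/0401215, Bombieri1976, FriedlanderIwaniecPisa1978, Chen1973, arXiv:2207.09452
[crux, rank 2; node SelbergDescent (lens-3 g2) beneath RobustRigidity 26469; tags WEAKER ·
ATTACKABLE-or-PRINT: UNDECIDED pending [Bo1] c₂(1/2), acq-14852 (critic ruling STATUS l.140: if
Bombieri 1975's level-1/2 constant certifies the literal, re-label KNOWN = formalisation task of a
1975 BV theorem and the node's open attackable content is SelbergTuples; else the leaf stands with
θ_rec := Bombieri's pair constant) · INSTRUMENTABLE · SIEGEL-INERT(heuristic)] Selberg lower bound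
at the Hardy–Littlewood constant for d = 1 systems of at most two forms: uniformly over
non-degenerate Ψ = (ψ₁, ψ₂) (or one form) with ‖Ψ‖_N ≤ L and convex K ⊆ [−N, N], β_∞·∏_p β_p − εN ≤
Σ_{n ∈ K} ∏_i w₂(ψ_i(n)) with the rank-2 (parity-neutral) weight w₂ = Λ + (Λ⋆Λ)/log = Λ₂/log
(Selberg's identity). WEAKER than GHL (kernel `selbergPairs_of_ghl`: termwise Λ ≤ w₂; converse
unknown) — it asks 25 % of the w₂⊗w₂ model 4·𝔖N, a total that is the same in both parity phases, so
EH ⟹ its fixed-shift slices is IN PRINT (Bombieri 1975/76: Σ_{p≤x} Λ_k(p+2) ∼ k𝔖x log^{k−1}x under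
R(ν) ∀ν<1, tree `Literature.NumberTheory.Sieve.bombieri_asymptotic_sieve_shiftedPrimes`) while EH ⇏
pair-HL (`…_indeterminacy`). Rung currenc -/
@[route_item "route-Parity-ShiftTauberian"]
def SelbergPairs : Prop :=
  ∀ (t L : ℕ), 1 ≤ t → t ≤ 2 → ∀ ε : ℝ, 0 < ε → ∃ N₀ : ℕ, ∀ N : ℕ, N₀ ≤ N → ∀ Ψ : Fin t → Literature.NumberTheory.Sieve.AffLinForm 1, Literature.NumberTheory.Sieve.IsNondegenerateSystem Ψ → Literature.NumberTheory.Sieve.affLinSize Ψ N ≤ L → ∀ K : Set (Fin 1 → ℝ), Convex ℝ K → K ⊆ Literature.NumberTheory.Sieve.realBox 1 N → Literature.NumberTheory.Sieve.archFactor Ψ K * Literature.NumberTheory.Sieve.singularProduct Ψ - ε * (N : ℝ) ≤ ∑ n ∈ (Literature.NumberTheory.Sieve.latticeBox 1 N).filter (fun n => Literature.NumberTheory.Sieve.realPoint n ∈ K), ∏ i : Fin t, (ArithmeticFunction.vonMangoldt ((Ψ i).eval n).toNat + (∑ x ∈ Nat.divisorsAntidiagonal ((Ψ i).eval n).toNat,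 ArithmeticFunction.vonMangoldt x.1 * ArithmeticFunction.vonMangoldt x.2) / Real.log ((((Ψ i).eval n).toNat : ℕ) : ℝ))

-- parent: RobustRigidity · child (gen 1)
/--     item stmt-Parity-27491 · crux · rank 202 · open
    parent: RobustRigidity · by planner
    why it might fail: Kernel-necessary (GHL ⟹ it), so false only with GHL. As a target: sieve dimension t−1 ≥ 2 has no switching principle and β-sieves output P₃₊ numbers where w₂ = 0; no positive rank-2 constant is known for any t ≥ 3 even under EH — may need a genuinely new device.
    sources: HeathBrown1997, Maynard2015, DiamondHalberstamGalway2008, GreenTao2010, Bombieri1976, FriedlanderIwaniecPisa1978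
[crux, rank 3; node SelbergDescent (lens-3 g2) beneath RobustRigidity 26469; tags WEAKER ·
IDEA-NEEDED(sieve dimension t−1 ≥ 2) · inner rank-ladder INSTRUMENTABLE · SIEGEL-INERT(heuristic)]
The same Selberg lower bound β_∞·∏β_p − εN ≤ Σ_{n∈K} ∏_{i≤t} w₂(ψ_i(n)) uniformly for non-degenerate
d = 1 systems of t ≥ 3 forms (2^{−t} of the w₂^{⊗t} model). WEAKER than GHL (kernel
`selbergTuples_of_ghl`); converse unknown. No c > 0 at rank 2 is in print for any t ≥ 3, even under
EH: fixing one prime variable leaves a (t−1 ≥ 2)-dimensional sieve problem with no switching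
principle, and w₂ vanishes on the P₃₊ almost-primes that β-sieve lower bounds
(Diamond–Halberstam–Richert, β₂ ≈ 4.83) produce — the IDEA-NEEDED tag. Inner ladder (rung currency =
rank k): for k ≥ k₁(t) the rank-k slice is theorem-grade by the t-dimensional fundamental lemma +
positivity of Λ_k on k-rough almost-primes (Heath-Brown 1997, Maynard 2013–15 almost-prime k-tuples
give the right ORDER in count currency); not split from the t ≤ 2 cell by any cheap calculus (⊠
leaves d = 1; dividing out a form costs sup w₂ ≍ log N — T9′/T9″/T10 checked). bc5: plan-only rung =
rank-k slice for k ≥ k₁(t) via fundamental lemma; bc8: Sel -/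
@[route_item "route-Parity-ShiftTauberian"]
def SelbergTuples : Prop :=
  ∀ (t L : ℕ), 3 ≤ t → ∀ ε : ℝ, 0 < ε → ∃ N₀ : ℕ, ∀ N : ℕ, N₀ ≤ N → ∀ Ψ : Fin t → Literature.NumberTheory.Sieve.AffLinForm 1, Literature.NumberTheory.Sieve.IsNondegenerateSystem Ψ → Literature.NumberTheory.Sieve.affLinSize Ψ N ≤ L → ∀ K : Set (Fin 1 → ℝ), Convex ℝ K → K ⊆ Literature.NumberTheory.Sieve.realBox 1 N → Literature.NumberTheory.Sieve.archFactor Ψ K * Literature.NumberTheory.Sieve.singularProduct Ψ - ε * (N : ℝ) ≤ ∑ n ∈ (Literature.NumberTheory.Sieve.latticeBox 1 N).filter (fun n => Literature.NumberTheory.Sieve.realPoint n ∈ K), ∏ i : Fin t, (ArithmeticFunction.vonMangoldt ((Ψ i).eval n).toNat + (∑ x ∈ Nat.divisorsAntidiagonal ((Ψ i).eval n).toNat, ArithmeticFunction.vonMangoldt x.1 * ArithmeticFunction.vonMangoldt x.2) / Real.log ((((Ψ i).eval n).toNat : ℕ) : ℝ))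

-- parent: RobustRigidity · child (gen 1)
/--     item stmt-Parity-27492 · crux · rank 203 · open
    parent: RobustRigidity · by planner
    why it might fail: Exactly as R (26469): a USZ-type world (Matomäki–Merikoski Thm 1.3, N = q^{10}) where the shift h₀ ≡ 0 (mod q) is off by a factor 2 while ≥ half of its primorial neighbours are exact would refute it; the added Sel₂ hypothesis holds there (parity-neutral), so it gives no protection.
    sources: arXiv:2112.07403, GreenTao2010, Literature.Barriers.Parity.PrimePairParity, Literature.Barriers.Parity.SiegelZeroPrimePairs, stmt-Parity-26469
[crux, rank 4; node SelbergDescent (lens-3 g2); tags DECLARED-RESIDUAL · TERMINAL for this lineage ·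
zero ladder credit claimed · SIEGEL-LOADED exactly as R] RobustRigidity (26469, born text verbatim)
with ONE extra hypothesis inserted after `K ⊆ [−N, N]`: the Sel₂-instance of the centre system,
β_∞(Ψ,K)·∏β_p(Ψ) − εN ≤ Σ_{n∈K} ∏_i w₂(ψ_i(n)). Kernel: R ⟹ RigidityDescent
(`rigidityDescent_of_robustRigidity`, residual ≤ last round's), GHL ⟹ it (`rigidityDescent_of_ghl`),
glue SelbergPairs → SelbergTuples → RigidityDescent → R (`robustRigidity_of_pieces`) and exactness
SelbergPairs → SelbergTuples → (R ↔ RigidityDescent). Honest status: strictly weaker than R only in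
worlds where Sel₂ fails at some centre; once both Selberg pieces are theorems it is ≡ R (declared,
T11(b)); it carries the whole rigidity content of R (neighbours HL-exact ⟹ centre HL-exact) and
inherits R's Siegel-scale risk (h₀ = 2q excess at N = q^{10}, Matomäki–Merikoski) verbatim.
residual: RigidityDescent. -/
@[route_item "route-Parity-ShiftTauberian"]
def RigidityDescent : Prop :=
  ∀ (t L : ℕ), 1 ≤ t → ∀ ε : ℝ, 0 < ε → ∃ N₀ : ℕ, ∀ N : ℕ, N₀ ≤ N → ∀ Ψ : Fin t → Literature.NumberTheory.Sieve.AffLinForm 1, Literature.NumberTheory.Sieve.IsNondegenerateSystem Ψ → Literature.NumberTheory.Sieve.affLinSize Ψ N ≤ L → ∀ K : Set (Fin 1 → ℝ), Convex ℝ K → K ⊆ Literature.NumberTheory.Sieve.realBox 1 N → (Literature.NumberTheory.Sieve.archFactor Ψ K * Literature.NumberTheory.Sieve.singularProduct Ψ - ε * (N : ℝ) ≤ ∑ n ∈ (Literature.NumberTheory.Sieve.latticeBox 1 N).filter (fun n => Literature.NumberTheory.Sieve.realPoint n ∈ K), ∏ i : Fin t, (ArithmeticFunction.vonMangoldt ((Ψ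 i).eval n).toNat + (∑ x ∈ Nat.divisorsAntidiagonal ((Ψ i).eval n).toNat, ArithmeticFunction.vonMangoldt x.1 * ArithmeticFunction.vonMangoldt x.2) / Real.log ((((Ψ i).eval n).toNat : ℕ) : ℝ))) → ∀ B ⊆ ((Fintype.piFinset fun _ : Fin t => Finset.range (2 ^ (7 * Nat.log 2 N / 30) + 1)).filter (fun c => ∀ i j : Fin t, i ≠ j → (Ψ i).coeff 0 * ((Ψ j).const + (primorial (max t L) : ℤ) * ((c j : ℕ) : ℤ)) ≠ (Ψ j).coeff 0 * ((Ψ i).const + (primorial (max t L) : ℤ) * ((c i : ℕ) : ℤ)))), 2 * B.card ≤ ((Fintype.piFinset fun _ : Fin t => Finset.range (2 ^ (7 * Nat.log 2 N / 30) + 1)).filter (fun c => ∀ i j : Fin t, i ≠ j → (Ψ i).coeff 0 * ((Ψ j).const + (primorial (max t L) : ℤ) * ((c j : ℕ) : ℤ)) ≠ (Ψ j).coeff 0 * ((Ψ i).const + (primorial (max t L) : ℤ) * ((c i : ℕ) : ℤ)))).card → (∀ c ∈ ((Fintype.piFinset fun _ : Fin t => Finset.range (2 ^ (7 * Nat.log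 2 N / 30) + 1)).filter (fun c => ∀ i j : Fin t, i ≠ j → (Ψ i).coeff 0 * ((Ψ j).const + (primorial (max t L) : ℤ) * ((c j : ℕ) : ℤ)) ≠ (Ψ j).coeff 0 * ((Ψ i).const + (primorial (max t L) : ℤ) * ((c i : ℕ) : ℤ)))), c ∉ B → |Literature.NumberTheory.Sieve.vonMangoldtSum (fun i : Fin t => (⟨(Ψ i).coeff, (Ψ i).const + (primorial (max t L) : ℤ) * ((c i : ℕ) : ℤ)⟩ : Literature.NumberTheory.Sieve.AffLinForm 1)) K N - Literature.NumberTheory.Sieve.archFactor (fun i : Fin t => (⟨(Ψ i).coeff, (Ψ i).const + (primorial (max t L) : ℤ) * ((c i : ℕ) : ℤ)⟩ : Literature.NumberTheory.Sieve.AffLinForm 1)) K * Literature.NumberTheory.Sieve.singularProduct (fun i : Fin t => (⟨(Ψ i).coeff, (Ψ i).const + (primorial (max t L) : ℤ) * ((c i : ℕ) : ℤ)⟩ : Literature.NumberTheory.Sieve.AffLinForm 1))| ≤ ε * (N : ℝ)) → |Literature.NumberTheory.Sieve.vonMangoldtSum Ψ K N - Literature.NumberTheory.Sieve.archFactor Ψ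 K * Literature.NumberTheory.Sieve.singularProduct Ψ| ≤ 2 * ε * (N : ℝ)

-- parent: RobustRigidity · glue (gen 1)
/--     item stmt-Parity-27493 · support · rank 204 · closed · proved by Summit.Parity.GeneralizedHardyLittlewood.Theses.ShiftTauberian.robustRigidityGlue_holds (prover)
    parent: RobustRigidity · GLUE: children ⟹ parent · by planner
SelbergPairs → SelbergTuples → RigidityDescent → RobustRigidity — kernel-proved in
HOME/decomp-parity-lens-3/g2/SelbergDescent.lean (theorem robustRigidity_of_pieces, axioms std);
READY-TO-LAND -/
@[route_item "route-Parity-ShiftTauberian"]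
def RobustRigidityGlue : Prop :=
  SelbergPairs → SelbergTuples → RigidityDescent → RobustRigidity

-- `RobustRigidityGlue` holds: proved by `Summit.Parity.GeneralizedHardyLittlewood.Theses.ShiftTauberian.robustRigidityGlue_holds` (its module imports this route file, so no `_holds` link can be stated here).

/-- item stmt-Parity-26470 · crux · rank 3 · open · by planner
why it might fail: θ = 7/30 < 8/33 needs a Type-d₃/d₄ large-values input beyond Robert–Sargos (MRT-I §1.5, the named obstruction); even A at 8/33 is printed only for centres h₀ ≤ X^(1−ε), here |h₀| ≤ LN; for t ≥ 3 no multi-shift result sharper than the pairs slice is in print; no power savings for Λ.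
sources: arXiv:1707.01315, arXiv:2411.05770, arXiv:2204.03754, Mikawa1992, Kawada1993
[crux] for every t ≥ 1, L, ε > 0 and all large N, every non-degenerate d = 1 system Ψ of t forms
with ‖Ψ‖_N ≤ L and every convex K ⊆ [−N,N]: there is an exceptional set B ⊆ G with #B ≤ ε·#G such
that every admissible neighbour c ∈ G ∖ B satisfies |S(Ψ_c,K) − β_∞(Ψ_c,K)𝔖(Ψ_c)| ≤ εN
(Hardy–Littlewood for almost all neighbours in the N^(7/30)-window along the primorial progression —
one exponent step below the Matomäki–Radziwiłł–Tao record 8/33 for pairs; for t ≥ 3 the statement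
contains the pairs slice by summing out the other shifts, and the printed tuple record — MRSTT-II
Thm 1.5, ONE averaging variable n, n+h, …, n+(ℓ−1)h at θ = 1/3 — is a different, harder shape, so A
is open for every t ≥ 2). [difficulty: XL] -/
@[route_item "route-Parity-ShiftTauberian"]
def WindowHL : Prop :=
  ∀ (t L : ℕ), 1 ≤ t → ∀ ε : ℝ, 0 < ε → ∃ N₀ : ℕ, ∀ N : ℕ, N₀ ≤ N → ∀ Ψ : Fin t → Literature.NumberTheory.Sieve.AffLinForm 1, Literature.NumberTheory.Sieve.IsNondegenerateSystem Ψ → Literature.NumberTheory.Sieve.affLinSize Ψ N ≤ L → ∀ K : Set (Fin 1 → ℝ), Convex ℝ K → K ⊆ Literature.NumberTheory.Sieve.realBox 1 N → ∃ B ⊆ ((Fintype.piFinset fun _ : Fin t => Finset.range (2 ^ (7 * Nat.log 2 N / 30) + 1)).filter (fun c => ∀ i j : Fin t, i ≠ j → (Ψ i).coeff 0 * ((Ψ j).const + (primorial (max t L) : ℤ) * ((c j : ℕ) : ℤ)) ≠ (Ψ j).coeff 0 * ((Ψ i).const + (primorial (max t L) : ℤ) * ((c i : ℕ) : ℤ)))),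 (B.card : ℝ) ≤ ε * (((Fintype.piFinset fun _ : Fin t => Finset.range (2 ^ (7 * Nat.log 2 N / 30) + 1)).filter (fun c => ∀ i j : Fin t, i ≠ j → (Ψ i).coeff 0 * ((Ψ j).const + (primorial (max t L) : ℤ) * ((c j : ℕ) : ℤ)) ≠ (Ψ j).coeff 0 * ((Ψ i).const + (primorial (max t L) : ℤ) * ((c i : ℕ) : ℤ)))).card : ℝ) ∧ ∀ c ∈ ((Fintype.piFinset fun _ : Fin t => Finset.range (2 ^ (7 * Nat.log 2 N / 30) + 1)).filter (fun c => ∀ i j : Fin t, i ≠ j → (Ψ i).coeff 0 * ((Ψ j).const + (primorial (max t L) : ℤ) * ((c j : ℕ) : ℤ)) ≠ (Ψ j).coeff 0 * ((Ψ i).const + (primorial (max t L) : ℤ) * ((c i : ℕ) : ℤ)))), c ∉ B → |Literature.NumberTheory.Sieve.vonMangoldtSum (fun i : Fin t => (⟨(Ψ i).coeff, (Ψ i).const + (primorial (max t L) : ℤ) * ((c i : ℕ) : ℤ)⟩ : Literature.NumberTheory.Sieve.AffLinForm 1)) K N - Literature.NumberTheory.Sieve.archFactor (fun i : Fin t =>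 (⟨(Ψ i).coeff, (Ψ i).const + (primorial (max t L) : ℤ) * ((c i : ℕ) : ℤ)⟩ : Literature.NumberTheory.Sieve.AffLinForm 1)) K * Literature.NumberTheory.Sieve.singularProduct (fun i : Fin t => (⟨(Ψ i).coeff, (Ψ i).const + (primorial (max t L) : ℤ) * ((c i : ℕ) : ℤ)⟩ : Literature.NumberTheory.Sieve.AffLinForm 1))| ≤ ε * (N : ℝ)

/-- item stmt-Parity-18286 · support · rank 9 · closed · proved by Summit.Parity.GeneralizedHardyLittlewood.Theses.ShiftTauberian.fibrationLift_proof (prover) · by planner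
sources: GreenTao2010, arXiv:math/0606088
[support] fibration lift (Green–Tao 2010, remark after Conj. 1.2): the one-dimensional statement —
Conj. 1.2 at d = 1, uniform in L (for all t ≥ 1, L, ε > 0 there is N₀ with |vonMangoldtSum Ψ K N −
archFactor Ψ K · singularProduct Ψ| ≤ εN for N ≥ N₀, every non-degenerate Ψ : Fin t → AffLinForm 1
with ‖Ψ‖_N ≤ L and every convex K ⊆ [−N,N]; inlined verbatim, no DimOne decl) — implies
GeneralizedHardyLittlewood. PROVED in the tree:
Theorems.FibrationGlue.generalizedHardyLittlewood_of_dimOne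
(Summits/Parity/GeneralizedHardyLittlewood/Theorems/LeeYangFibresFibrationLemmaFinal.lean, standard
axioms) has exactly this antecedent, so `theorem fibrationLift_proof : FibrationLift := fun h =>
FibrationGlue.generalizedHardyLittlewood_of_dimOne h` closes it in one line from a Theorems file
importing that module. It is a hypothesis of `closes` (as FibrationLemma stmt-Parity-0822 is in
route LeeYangFibres) precisely so that the ROUTE FILE imports no Theorems module and its file-level
cone is the Statement's own (rev 16, rbadge g4). [difficulty: provable-now] -/
@[route_item "route-Parity-ShiftTauberian"]
def FibrationLift : Prop :=
  (∀ (t L : ℕ), 1 ≤ t → ∀ ε : ℝ, 0 < ε → ∃ N₀ : ℕ, ∀ N : ℕ, N₀ ≤ N → ∀ Ψ : Fin t → Literature.NumberTheory.Sieve.AffLinForm 1, Literature.NumberTheory.Sieve.IsNondegenerateSystem Ψ → Literature.NumberTheory.Sieve.affLinSize Ψ N ≤ L → ∀ K : Set (Fin 1 → ℝ), Convex ℝ K → K ⊆ Literature.NumberTheory.Sieve.realBox 1 N → |Literature.NumberTheory.Sieve.vonMangoldtSum Ψ K N - Literature.NumberTheory.Sieve.archFactor Ψ K * Literature.NumberTheory.Sieve.singularProduct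 Ψ| ≤ ε * (N : ℝ)) → GeneralizedHardyLittlewood

-- `FibrationLift` holds: proved by `Summit.Parity.GeneralizedHardyLittlewood.Theses.ShiftTauberian.fibrationLift_proof` (its module imports this route file, so no `_holds` link can be stated here).

/-- item stmt-Parity-26471 · assembly · rank 1 · closed · proved by Summit.Parity.GeneralizedHardyLittlewood.Theses.ShiftTauberian.assembly_proof (prover) · by planner
sources: GreenTao2010, arXiv:1707.01315
[assembly] WindowHL → RobustRigidity → FibrationLift → GeneralizedHardyLittlewood. -/
@[route_item "route-Parity-ShiftTauberian"]
def Assembly : Prop :=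
  Summit.Parity.GeneralizedHardyLittlewood.Theses.ShiftTauberian.WindowHL → Summit.Parity.GeneralizedHardyLittlewood.Theses.ShiftTauberian.RobustRigidity → Summit.Parity.GeneralizedHardyLittlewood.Theses.ShiftTauberian.FibrationLift → GeneralizedHardyLittlewood

-- `Assembly` holds: proved by `Summit.Parity.GeneralizedHardyLittlewood.Theses.ShiftTauberian.assembly_proof` (its module imports this route file, so no `_holds` link can be stated here).

/-! D-0027 §2.1 — DECIDING THEOREM (planner-authored via `route open/edit --closes-file`; by planner-decomp-parity-lens-3-g0-0 2026-08-30T03:14:35Z):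
its hypotheses are this route's items and its conclusion the sub-problem Statement (glue_lint), and it elaborates with this file. -/

@[closes "route-Parity-ShiftTauberian"] theorem closes (hA : WindowHL) (hR : RobustRigidity) (hF : FibrationLift) : GeneralizedHardyLittlewood := by
  refine hF ?_
  intro t L ht ε hε
  have hε2 : 0 < ε / 2 := by positivity
  have hη : 0 < min (ε / 2) (1 / 2) := lt_min hε2 (by norm_num)
  obtain ⟨N₁, h₁⟩ := hA t L ht (min (ε / 2) (1 / 2)) hη
  obtain ⟨N₂, h₂⟩ := hR t L ht (ε / 2) hε2
  refine ⟨max N₁ N₂, fun N hN Ψ hΨ hL K hK hKN => ?_⟩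
  set G := ((Fintype.piFinset fun _ : Fin t => Finset.range (2 ^ (7 * Nat.log 2 N / 30) + 1)).filter (fun c => ∀ i j : Fin t, i ≠ j → (Ψ i).coeff 0 * ((Ψ j).const + (primorial (max t L) : ℤ) * ((c j : ℕ) : ℤ)) ≠ (Ψ j).coeff 0 * ((Ψ i).const + (primorial (max t L) : ℤ) * ((c i : ℕ) : ℤ)))) with hGdef
  obtain ⟨B, hBG, hBcard, hgood⟩ := h₁ N (le_trans (le_max_left _ _) hN) Ψ hΨ hL K hK hKN
  -- Markov: an exceptional set of proportion ≤ min (ε/2) (1/2) ≤ 1/2 is a minority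
  have hmin : min (ε / 2) (1 / 2) ≤ 1 / 2 := min_le_right _ _
  have hG0 : (0 : ℝ) ≤ (G.card : ℝ) := Nat.cast_nonneg _
  have h2 : ((2 * B.card : ℕ) : ℝ) ≤ (G.card : ℝ) := by push_cast; nlinarith
  have key := h₂ N (le_trans (le_max_right _ _) hN) Ψ hΨ hL K hK hKN B hBG (by exact_mod_cast h2)
    (fun c hc hcB => (hgood c hc hcB).trans (by gcongr; exact min_le_left _ _))
  linarith

end Summit.Parity.GeneralizedHardyLittlewood.Theses.ShiftTauberian
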